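import Literature.AlgebraicGeometry.HodgeTheory.UnitaryTypeSlotsHodgeClasses
import Literature.AlgebraicGeometry.Motives.HodgeThetaSubalgebraUnitarySocket
import HarnessLib

/-!
# `Hg = U_K` ⟹ the Hodge classes on all powers are generated by divisor classes, I: Theorem L′ and the invariance theorem with the Lie step as a hypothesis (Moonen–Zarhin 1999 (1.8), Hazama / Murty, for `D = K` imaginary quadratic; Ribet 1983 Thm. 3, any multiplicities)

Family `hodge`, layer `Literature/AlgebraicGeometry/HodgeTheory`. Research context: cell `pub-hodgeav-hg6` (LADDER-HodgeAV
PERC-SHAPE row 2, «base of HC ladder», req-37 Q2b TABLE X; HONEST FRAMING: nothing here proves HC, HC_AV or HC_CM;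
research route conditional on HC_CM where HC_CM appears — it does not appear here; not a corollary). UNCONDITIONAL for
the class of abelian varieties it names; theorems only, no definition, no named fact (D-0026), no `sorry`. Part I of two
(sequel: `UnitaryHodgeGroupPowersHodgeClasses` — the FFT assembly and the geometric theorem).

This is the UNITARY twin of the tree's `SymplecticHodgeGroupPowersHodgeClasses` §2 («`Hg = Sp`», Lie input = hypothesis
`hsp`) and the MULTIPLICITY-FREE form of `UnitaryTypeSlotsHodgeClasses` §3 (Ribet type `(m,1)`) /
`RibetTypeTwoThreePowersHodgeClasses` §2 (type `(2,3)`): there the Lie step «`Lie Hg(H¹(A)) ⊗ ℂ ⊇ 𝔲_K(V,ψ) ⊗ ℂ ≅ 𝔤𝔩(W)`»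
is PROVED from the multiplicities by THEOREM L′ / L″; here it is the HYPOTHESIS `hU` — «every `φ_ℂ`-commuting `ψ_ℂ`-skew
operator of `H¹(A; ℂ)` lies in `Lie Hg ⊗ ℂ`», i.e. `Hg(A) = U_K(V, ψ)` — valid verbatim for every pair of multiplicities
`(n′, n″)`. The `(m,1)` and `(2,3)` invariance theorems are the instances `hU :=` THEOREM L′
(`UnitaryTheta.mem_spanC_of_commute_of_skew`) / L″ (library debt: they could now be short corollaries; not refiled here).
CREDIT: the 190-line letter transport in §2 (adapted ↔ rational letters, `Θ = diag(±1)`) is COPIED from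
`AVSlots.exists_unitaryInvariant_coeff` (cell pub-hodge-ring2, programme R9) with its one Lie line replaced; nothing else
is re-proved.

THE PRINT. Moonen–Zarhin 1999 (1.8) [corpus: paper:arxiv-math_9901113 p0004 L72–88]: «the Hodge group `Hg(X)` is
contained in the algebraic group `Sp_D(V,φ)` [the centralizer of `D = End⁰(X)` in `Sp(V,φ)`]. It was shown by Hazama and
Murty (independently) that `Hg(X) = Sp_D(V,φ)` ⟺ (`X` has no factors of type III and `D(Xⁿ) = B(Xⁿ)` for all `n`).» For
`D = K` imaginary quadratic, `Sp_K(V,φ) = U_K(V,ψ)` (ibid. (2.3)), with complex points `GL(W)`, `V_ℂ = W ⊕ W'` (Gordon 1997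
§6 p. 19: «extend scalars to `ℂ`, so that the unitary group … becomes a general linear group»).

MAIN RESULTS.
* §1 `HodgeStructure.UnitaryTheta.wordDerAt_eq_zero_of_commute_of_skew_of_hodgeLieC` — THEOREM L′ under `hU` (any
  weight, any multiplicities): a rational coefficient tensor killed by `Θ` is killed by every `φ_ℂ`-commuting `ψ_ℂ`-skew
  `Y` (annihilator algebra admissible; propagation `UnitaryTheta.mem_spanC_of_commute_of_skew_of_hodgeLieC`, Deligne's
  minimality).
* §2 `AVSlots.exists_unitaryInvariant_coeff_of_hodgeLieC` — THE INVARIANCE THEOREM under `hU`: every rational `(p,p)`-class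
  on an abelian variety `B` with slots over `A` is `∑_w a(w)·(g e, g f)_w` with slices killed by the typed differential of
  EVERY `X ∈ 𝔤𝔩_{n₀}(ℂ)` (`X` on the `W`-letters, `-Xᵀ` on the `W'`-letters).

## References

* [MoonenZarhin1999LowDim] B. Moonen, Yu. Zarhin, *Hodge classes on abelian varieties of low dimension*, Math. Ann.
  315 (1999) = arXiv:math/9901113 (held `paper:arxiv-math_9901113`), §1 (1.8), §2 (2.3), §3 (3.1).
* [Hazama1983] F. Hazama, Tôhoku Math. J. 35 (1983), Thm. (1.1), §3 pp. 305–306.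
* [Murty1984] V. K. Murty, *Exceptional Hodge classes on certain abelian varieties*, Math. Ann. 268 (1984), Thm. 3.1, §3.
* [Ribet1983] K. A. Ribet, *Hodge classes on certain types of abelian varieties*, Amer. J. Math. 105 (1983), Thm. 0 and Thm. 3.
* [Gordon1997] B. B. Gordon, *A survey of the Hodge conjecture for abelian varieties*, arXiv:alg-geom/9709030, Thm. 6.3 (3), §6 pp. 18–19.
* [Deligne1982HodgeCycles] P. Deligne, *Hodge cycles on abelian varieties*, LNM 900 (1982), I §3 Prop. 3.4.
* [GoodmanWallachGTM255] R. Goodman, N. R. Wallach, GTM 255 (2009), §4.1.1.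
* [VoisinHodgeI2002] C. Voisin, *Hodge Theory and Complex Algebraic Geometry I*, §7.1.2 Def. 7.7.
-/

noncomputable section

open scoped TensorProduct
open scoped Matrix
open CategoryTheory Module

/-! ### §1 Theorem L′ under `Hg = U_K`: rational tensors killed by `Θ` are killed by every `φ_ℂ`-commuting `ψ_ℂ`-skew operator -/

namespace Literature.AlgebraicGeometry.Motives

namespace HodgeStructure

section AnnLie

open Literature.RepresentationTheory.GeneralLinear Literature.NumberTheory.DiophantineGeometry

universe u

variable {V : Type u} [AddCommGroup V] [Module ℚ V] {n : ℤ} {M N k : ℕ}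

/-- **Theorem L′ under `(Lie Hg)_ℂ ⊇ 𝔲_K(V,ψ)_ℂ` (invariance of rational tensors; any weight, any multiplicities).**
Let `q` be a rational coefficient tensor (letters: slots `Fin k` × a `ℚ`-basis `eQ` of `V`) killed — slice by slice,
diagonally — by the matrix of the Hodge operator `Θ`, and assume `hU`: every `φ_ℂ`-commuting `ψ_ℂ`-skew operator lies in
`Lie Hg(H) ⊗ ℂ`. Then `q` is killed by the matrix of EVERY `φ_ℂ`-commuting `ψ_ℂ`-skew operator `Y`: the rational Lie
algebra `𝔞` of operators killing `q`, commuting with `End_Hdg` and `ψ`-skew (`annLie`) is bracket-closed with `Θ ∈ 𝔞_ℂ`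
by descent (`mem_spanC_annLie`), so `Y ∈ 𝔞_ℂ` by the propagation lemma
`UnitaryTheta.mem_spanC_of_commute_of_skew_of_hodgeLieC` (Deligne's minimality), and `𝔞_ℂ` kills `q_ℂ`. This is the
tree's THEOREM L′ (`UnitaryTheta.wordDerAt_eq_zero_of_commute_of_skew`, type `(m,1)`) with its Lie theorem replaced by
the hypothesis. MZ99 (1.8): «`Hg(X) = Sp_D(V,φ)` ⟺ … `D(Xⁿ) = B(Xⁿ)` for all `n`» (Hazama, Murty).
[cite: MoonenZarhin1999LowDim, §1 (1.8) and §3 (3.1)] [cite: Deligne1982HodgeCycles, I §3 (proof of Prop. 3.4)]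
[cite: Gordon1997, §6 (pp. 18–19)] -/
theorem UnitaryTheta.wordDerAt_eq_zero_of_commute_of_skew_of_hodgeLieC [Module.Finite ℚ V] [HodgeTensorFacts.{u, u}]
    (H : HodgeStructure V n) (ψ : H.Polarization) {φ : Module.End ℚ V}
    (hU : ∀ Y : Module.End ℂ (ℂ ⊗[ℚ] V), Y * φ.baseChange ℂ = φ.baseChange ℂ * Y →
      (∀ x y, ψ.form.baseChange ℂ (Y x) y + ψ.form.baseChange ℂ x (Y y) = 0) → Y ∈ H.hodgeLieC)
    (eQ : Module.Basis (Fin M) ℚ V) (q : (Fin N → Fin k × Fin M) → ℚ) {Θ : Module.End ℂ (ℂ ⊗[ℚ] V)}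
    (hΘ : ∀ p, ∀ x ∈ H.piece p (n - p), Θ x = ((2 * p - n : ℤ) : ℂ) • x)
    (hΘq : ∀ u : Fin N → Fin k, wordDerAt ℂ (fun _ : Fin N =>
      LinearMap.toMatrix (Algebra.TensorProduct.basis ℂ eQ) (Algebra.TensorProduct.basis ℂ eQ) Θ)
      (wordSlice (fun w => algebraMap ℚ ℂ (q w)) u) = 0)
    {Y : Module.End ℂ (ℂ ⊗[ℚ] V)} (hYφ : Y * φ.baseChange ℂ = φ.baseChange ℂ * Y)
    (hYskew : ∀ x y, ψ.form.baseChange ℂ (Y x) y + ψ.form.baseChange ℂ x (Y y) = 0)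
    (u : Fin N → Fin k) :
    wordDerAt ℂ (fun _ : Fin N =>
      LinearMap.toMatrix (Algebra.TensorProduct.basis ℂ eQ) (Algebra.TensorProduct.basis ℂ eQ) Y)
      (wordSlice (fun w => algebraMap ℚ ℂ (q w)) u) = 0 := by
  -- the rational Lie algebra `𝔞 ⊆ 𝔲_K(V, ψ)` of `q`, with `E = End_Hdg(V)` as the commuting family
  set 𝔞 : Submodule ℚ (Module.End ℚ V) := annLie ψ.form eQ (fun a : H.endAlg => (a : Module.End ℚ V)) q
    with h𝔞
  have hΘC : Θ ∈ H.hodgeLieC := H.mem_hodgeLieC_of_forall_piece hΘ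
  have hΘ𝔞 : Θ ∈ spanC 𝔞 :=
    mem_spanC_annLie ψ.form eQ _ q hΘq (fun a => commute_baseChange_of_mem_hodgeLieC H hΘC a)
      fun x y => by rw [formBaseChange_skew_of_mem_hodgeLieC ψ hΘC, neg_add_cancel]
  have hbr : ∀ X ∈ 𝔞, ∀ X' ∈ 𝔞, X * X' - X' * X ∈ 𝔞 := fun X hX X' hX' =>
    commutator_mem_annLie ψ.form eQ _ q hX hX'
  have hY : Y ∈ spanC 𝔞 :=
    UnitaryTheta.mem_spanC_of_commute_of_skew_of_hodgeLieC H ψ hU 𝔞 hbr hΘ hΘ𝔞 hYφ hYskew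
  rw [h𝔞] at hY
  exact wordDerAt_eq_zero_of_mem_spanC_annLie ψ.form eQ _ q hY u

end AnnLie

end HodgeStructure

end Literature.AlgebraicGeometry.Motives

/-! ### §2 The invariance theorem under `Hg = U_K`: slices of the coefficient function of a Hodge class are killed by `𝔤𝔩(W)` acting by `X ⊕ (-Xᵀ)` -/

namespace Literature.AlgebraicGeometry.HodgeTheory

open Literature.AlgebraicTopology.SingularHomology
open Literature.AlgebraicGeometry.Motives (IsSmoothProjective AbelianVariety bettiCohomology
  ofRatClassBaseChange ofRatClassBaseChange_tmul HodgeTensorFacts hodgeTensorFacts_holds)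
open Literature.Barriers.HodgeConjecture
open Literature.AlgebraicGeometry.Motives.HodgeStructure
open Literature.RepresentationTheory.GeneralLinear
open Literature.RepresentationTheory.ClassicalInvariants
open Literature.NumberTheory.DiophantineGeometry

section Invariance

variable {A B : AbelianVariety ℂ} {n : ℕ} {g : Fin n → (B ⟶ A)}

/-- The two elements of `Fin 2`. [folklore] -/
private theorem fin2_cases' (r : Fin 2) : r = 0 ∨ r = 1 := by
  fin_cases r <;> simp

open scoped Classical in
/-- **THE INVARIANCE THEOREM under `Hg = U_K` (MZ99 (1.8) / Ribet 1983 Thm. 3, Lie step as hypothesis; abelian varieties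
with slots over `A` of unitary type with ANY multiplicities).** Let `A` be a complex abelian variety whose
`H = H¹(A(ℂ); ℚ)` carries a polarization `ψ` and an imaginary quadratic structure `φ ∈ End_Hdg(H)` (`φ² = -d < 0`,
`End_Hdg(H) = ℚ + ℚφ`) such that `Lie Hg(H) ⊗ ℂ` contains every `φ_ℂ`-commuting `ψ_ℂ`-skew operator (`hU`), let
`(e_ℓ, f_ℓ) = (cb(0,ℓ), cb(1,ℓ))` be adapted `ψ_ℂ`-dual bases of `W ⊕ W'` (`W = ker(φ_ℂ - μ)`, `μ² = -d`;
`UnitaryTheta.exists_adaptedDualBasis`), and `B` an abelian variety with slots `g` over `A`. Then every rational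
`(p,p)`-class `c` on `B` (`p ≥ 1`) is `∑_w a(w) · (g e, g f)_w` for a coefficient function `a` on words in the letters
`((j, t), ℓ)` (slot, type, index) such that for every slot-and-type word `U` and EVERY `X ∈ 𝔤𝔩_{n₀}(ℂ)` the typed
differential of `X` (`X` at the positions of type `0` = vector = `W`, `-Xᵀ` at the positions of type `1` = covector =
`W'`) kills the slice `a(U, −)`: the operator `Y_X` with matrix `X ⊕ (-Xᵀ)` in the letters commutes with `φ_ℂ` and is
`ψ_ℂ`-skew (duality and isotropy of `W`, `W'`), so §1 applies. The letter transport (adapted ↔ rational letters,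
`Θ = diag(±1)` in the adapted letters) is VERBATIM that of the tree's `AVSlots.exists_unitaryInvariant_coeff` (type
`(m,1)`, cell pub-hodge-ring2, programme R9), which is the instance `hU :=` THEOREM L′. Gordon: «the induced map
`MT(A, ℂ) → GL(W')` is surjective … extend scalars to `ℂ`, so that the unitary group becomes a general linear group».
[cite: MoonenZarhin1999LowDim, §1 (1.8) and §3 (3.1)] [cite: Ribet1983, Thm. 0 and Thm. 3]
[cite: Gordon1997, §6 (proof of Thm. 6.3.3, pp. 18–19)] -/
theorem AVSlots.exists_unitaryInvariant_coeff_of_hodgeLieC [HodgeTensorFacts.{0, 0}] (hg : AVSlots A B g)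
    (hHD : exists_isReal_hodgeModel) (hI : hodgePQ_independent_of_hodgeModel)
    (ψ : (BettiUniverse.hodge hHD (AbelianVariety.isSmoothProjective_holds (A := A)) 1).Polarization)
    {φ : Module.End ℚ (bettiCohomology A.X 1)}
    (hφE : φ ∈ (BettiUniverse.hodge hHD (AbelianVariety.isSmoothProjective_holds (A := A)) 1).endAlg)
    {d : ℚ} (hd : 0 < d) (hφ2 : φ * φ = -(d • 1))
    (hE : ∀ a ∈ (BettiUniverse.hodge hHD (AbelianVariety.isSmoothProjective_holds (A := A)) 1).endAlg,
      ∃ x y : ℚ, a = x • 1 + y • φ)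
    (hU : ∀ Y : Module.End ℂ (ℂ ⊗[ℚ] bettiCohomology A.X 1), Y * φ.baseChange ℂ = φ.baseChange ℂ * Y →
      (∀ x y, ψ.form.baseChange ℂ (Y x) y + ψ.form.baseChange ℂ x (Y y) = 0) →
        Y ∈ (BettiUniverse.hodge hHD (AbelianVariety.isSmoothProjective_holds (A := A)) 1).hodgeLieC)
    {μ : ℂ} (hμ : μ ^ 2 = -(d : ℂ))
    {n₀ : ℕ} (cb : Module.Basis (Fin 2 × Fin n₀) ℂ (ℂ ⊗[ℚ] bettiCohomology A.X 1)) (κ : Fin n₀ → Fin 2)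
    (hcbW : ∀ ℓ, cb (0, ℓ) ∈ Module.End.eigenspace (φ.baseChange ℂ) μ)
    (hcbW' : ∀ ℓ, cb (1, ℓ) ∈ Module.End.eigenspace (φ.baseChange ℂ) (-μ))
    (hcb0 : ∀ ℓ, κ ℓ = 0 →
      cb (0, ℓ) ∈ (BettiUniverse.hodge hHD (AbelianVariety.isSmoothProjective_holds (A := A)) 1).piece 1 0 ∧
      cb (1, ℓ) ∈ (BettiUniverse.hodge hHD (AbelianVariety.isSmoothProjective_holds (A := A)) 1).piece 0 1)
    (hcb1 : ∀ ℓ, κ ℓ = 1 →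
      cb (0, ℓ) ∈ (BettiUniverse.hodge hHD (AbelianVariety.isSmoothProjective_holds (A := A)) 1).piece 0 1 ∧
      cb (1, ℓ) ∈ (BettiUniverse.hodge hHD (AbelianVariety.isSmoothProjective_holds (A := A)) 1).piece 1 0)
    (hdual : ∀ i j, ψ.form.baseChange ℂ (cb (0, i)) (cb (1, j)) = if i = j then 1 else 0)
    {p : ℕ} (hp : 0 < p) {c : complexBetti B.X (2 * p)} (hcQ : IsRationalClass c)
    (hc : IsOfHodgeType B.dim B.X (2 * p) p p c) :
    ∃ a : (Fin (2 * p) → (Fin n × Fin 2) × Fin n₀) → ℂ,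
      wordEval (cupPowOneAlt ℂ (Motives.ComplexPoints B.X) (2 * p))
        (fun x : (Fin n × Fin 2) × Fin n₀ => avLetters g (fun tl : Fin 2 × Fin n₀ =>
          ofRatClassBaseChange (Motives.ComplexPoints A.X) 1 (cb tl)) (x.1.1, (x.1.2, x.2))) a = c ∧
      ∀ (U : Fin (2 * p) → Fin n × Fin 2) (X : Matrix (Fin n₀) (Fin n₀) ℂ),
        wordDerAt ℂ (fun t => if (U t).2 = 0 then X else -Xᵀ) (wordSlice a U) = 0 := by
  classical
  -- (the letter transport below is that of `AVSlots.exists_unitaryInvariant_coeff`, cell pub-hodge-ring2, R9)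
  -- the setting
  have hX : IsSmoothProjective A.dim A.X := AbelianVariety.isSmoothProjective_holds
  haveI : Module.Finite ℚ (bettiCohomology A.X 1) := finite_bettiCohomology_one A
  have hn1 : (((1 : ℕ) : ℤ)) = 1 := Nat.cast_one
  have heff := BettiUniverse.hodge_isEffective hHD hX 1
  obtain ⟨hμ0, -⟩ := UnitaryTheta.conj_eq_neg_of_sq hd hμ
  set F := cupPowOneAlt ℂ (Motives.ComplexPoints B.X) (2 * p) with hFdef
  have hFinj : Function.Injective (exteriorPower.alternatingMapLinearEquiv F) :=
    injective_alternatingMapLinearEquiv_cupPowOneAlt B (2 * p)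
  -- bases: the adapted basis `cbσ` and the rational basis `eC`, both indexed by `Fin M`
  set eQ := Module.finBasis ℚ (bettiCohomology A.X 1) with heQ
  set eC : Module.Basis (Fin (Module.finrank ℚ (bettiCohomology A.X 1))) ℂ
    (ℂ ⊗[ℚ] bettiCohomology A.X 1) := Algebra.TensorProduct.basis ℂ eQ with heC
  set φι : Fin (Module.finrank ℚ (bettiCohomology A.X 1)) ≃ Fin 2 × Fin n₀ := eC.indexEquiv cb with hφι
  set cbσ : Module.Basis (Fin (Module.finrank ℚ (bettiCohomology A.X 1))) ℂ
    (ℂ ⊗[ℚ] bettiCohomology A.X 1) := cb.reindex φι.symm with hcbσdef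
  have hcbσ : ∀ m, cbσ m = cb (φι m) := fun m => by
    rw [hcbσdef, Module.Basis.reindex_apply, Equiv.symm_symm]
  -- kinds of the adapted letters
  set κ2 : Fin 2 × Fin n₀ → Fin 2 := fun tl => if tl.1 = 0 then κ tl.2 else (if κ tl.2 = 0 then 1 else 0)
    with hκ2
  have hkind : ∀ tl : Fin 2 × Fin n₀,
      (κ2 tl = 0 → cb tl ∈ (BettiUniverse.hodge hHD (AbelianVariety.isSmoothProjective_holds (A := A)) 1).piece 1 0) ∧
      (κ2 tl = 1 → cb tl ∈ (BettiUniverse.hodge hHD (AbelianVariety.isSmoothProjective_holds (A := A)) 1).piece 0 1) := by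
    rintro ⟨t, ℓ⟩
    rcases fin2_cases' t with rfl | rfl <;> rcases fin2_cases' (κ ℓ) with h | h
    · have hk : κ2 (0, ℓ) = 0 := by simp [hκ2, h]
      rw [hk]
      exact ⟨fun _ => (hcb0 ℓ h).1, fun h' => absurd h' (by decide)⟩
    · have hk : κ2 (0, ℓ) = 1 := by simp [hκ2, h]
      rw [hk]
      exact ⟨fun h' => absurd h' (by decide), fun _ => (hcb1 ℓ h).1⟩
    · have hk : κ2 (1, ℓ) = 1 := by simp [hκ2, h]
      rw [hk]
      exact ⟨fun h' => absurd h' (by decide), fun _ => (hcb0 ℓ h).2⟩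
    · have hk : κ2 (1, ℓ) = 0 := by simp [hκ2, h]
      rw [hk]
      exact ⟨fun _ => (hcb1 ℓ h).2, fun h' => absurd h' (by decide)⟩
  set κ' : Fin (Module.finrank ℚ (bettiCohomology A.X 1)) → Fin 2 := fun m => κ2 (φι m) with hκ'
  -- letters
  set ρ := ofRatClassBaseChangeEquiv hX 1 with hρ
  set v : Module.Basis _ ℂ (complexBetti A.X 1) := cbσ.map ρ with hv
  set eL : Module.Basis _ ℂ (complexBetti A.X 1) := eC.map ρ with heL
  have heLQ : ∀ i, IsRationalClass (eL i) := fun i => by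
    rw [heL, Module.Basis.map_apply, heC, Algebra.TensorProduct.basis_apply, hρ,
      ofRatClassBaseChangeEquiv_apply, ofRatClassBaseChange_tmul, one_smul]
    exact isRationalClass_ofRatClass _
  have hv_apply : ∀ m, v m = ofRatClassBaseChange (Motives.ComplexPoints A.X) 1 (cb (φι m)) := fun m => by
    rw [hv, Module.Basis.map_apply, hcbσ, hρ, ofRatClassBaseChangeEquiv_apply]
  have hv0 : ∀ m, κ' m = 0 → IsOfHodgeType A.dim A.X 1 1 0 (v m) := by
    intro m hm
    rw [hv_apply, ← BettiUniverse.mem_hodge_piece_iff hHD hI hX (k := 1) (p := 1) (q := 0) rfl]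
    exact (hkind (φι m)).1 hm
  have hv1 : ∀ m, κ' m = 1 → IsOfHodgeType A.dim A.X 1 0 1 (v m) := by
    intro m hm
    rw [hv_apply, ← BettiUniverse.mem_hodge_piece_iff hHD hI hX (k := 1) (p := 0) (q := 1) rfl]
    exact (hkind (φι m)).2 hm
  -- (α) an antisymmetric kind-balanced coefficient function in the adapted letters
  obtain ⟨ax, hax_bal, hax_anti, hcax⟩ := hg.exists_antisymm_kindBalanced_wordEval_eq v κ' hv0 hv1 hp hc
  -- the change of letters to the rational letters
  set G : Matrix _ _ ℂ := eC.toMatrix cbσ with hG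
  set G' : Matrix _ _ ℂ := cbσ.toMatrix eC with hG'
  have hG'G : G' * G = 1 := cbσ.toMatrix_mul_toMatrix_flip eC
  have hve : ∀ m, v m = ∑ i, G i m • eL i := fun m => by
    simp only [hv, heL, Module.Basis.map_apply, ← map_smul, ← map_sum]
    congr 1
    exact (eC.sum_toMatrix_smul_self (v := ⇑cbσ) (j := m)).symm
  have hletters : ∀ j m, avLetters g v (j, m) = ∑ i, G i m • avLetters g eL (j, i) :=
    avLetters_baseChange g G hve
  set aE := colourChangeAt (fun _ : Fin n => G) ax with haE
  have haE_anti : IsAntisymm aE := hax_anti.colourChangeAt _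
  have hcaE : wordEval F (avLetters g eL) aE = c := by
    rw [haE, ← wordEval_eq_wordEval_colourChangeAt F (fun _ : Fin n => G) hletters ax, hcax]
  -- rationality of `aE`
  obtain ⟨q, hq⟩ := hg.exists_rat_wordEval_eq eL heLQ hcQ
  obtain ⟨q', -, haEq⟩ := haE_anti.exists_eq_algebraMap_of_wordEval_eq hFinj (hg.letterBasis eL)
    (q := q) (by rw [AVSlots.coe_letterBasis, hcaE, hFdef, hq])
  have hslice_e : ∀ u, wordSlice aE u = wordRepAt ℂ (fun _ : Fin (2 * p) => G) (wordSlice ax u) :=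
    fun u => wordSlice_colourChangeAt (fun _ : Fin n => G) ax u
  -- the Hodge operator `Θ`: `diag(±1)` in the adapted letters
  obtain ⟨Θ, hΘ⟩ := exists_hodgeTheta (BettiUniverse.hodge hHD (AbelianVariety.isSmoothProjective_holds (A := A)) 1)
  obtain ⟨-, -, hΘ10, hΘ01, -⟩ :=
    UnitaryTheta.theta_facts (BettiUniverse.hodge hHD (AbelianVariety.isSmoothProjective_holds (A := A)) 1)
      hn1 heff hΘ
  have hΘb : ∀ m, Θ (cbσ m) = (if κ' m = 0 then (1 : ℂ) else -1) • cbσ m := by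
    intro m
    rw [hcbσ]
    rcases fin2_cases' (κ' m) with h0 | h1'
    · rw [h0, if_pos rfl, one_smul]
      exact hΘ10 _ ((hkind (φι m)).1 h0)
    · rw [h1', if_neg one_ne_zero, neg_one_smul]
      exact hΘ01 _ ((hkind (φι m)).2 h1')
  have hΘcb : LinearMap.toMatrix cbσ cbσ Θ = kindDiag κ' := by
    ext i m
    rw [LinearMap.toMatrix_apply, hΘb, map_smul, Module.Basis.repr_self, Finsupp.smul_apply,
      Finsupp.single_apply, kindDiag, Matrix.diagonal_apply, smul_eq_mul, mul_ite, mul_one, mul_zero]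
    by_cases him : i = m
    · subst him; rw [if_pos rfl]
    · rw [if_neg (Ne.symm him), if_neg him]
  have hJG : LinearMap.toMatrix eC eC Θ * G = G * kindDiag κ' := by
    rw [← hΘcb, hG, linearMap_toMatrix_mul_basis_toMatrix, basis_toMatrix_mul_linearMap_toMatrix]
  have hΘq : ∀ u : Fin (2 * p) → Fin n, wordDerAt ℂ (fun _ : Fin (2 * p) => LinearMap.toMatrix eC eC Θ)
      (wordSlice (fun w => algebraMap ℚ ℂ (q' w)) u) = 0 := by
    intro u
    rw [← haEq, hslice_e]
    refine wordDerAt_wordRepAt_eq_zero_of_mul_eq ℂ (fun _ : Fin (2 * p) => G) (fun _ => hJG) ?_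
    rw [wordDerAt_const]
    exact wordDer_kindDiag_wordSlice_eq_zero κ' hax_bal u
  -- structure of the adapted basis for `ψ_ℂ` and `φ_ℂ`
  set ψC := ψ.form.baseChange ℂ with hψC
  have hφskewC : ∀ x y, ψC (φ.baseChange ℂ x) y + ψC x (φ.baseChange ℂ y) = 0 := by
    rcases subsingleton_or_nontrivial (bettiCohomology A.X 1) with hV | hV
    · haveI : Subsingleton (ℂ ⊗[ℚ] bettiCohomology A.X 1) := by
        refine ⟨fun x y => ?_⟩
        have h : ∀ z : ℂ ⊗[ℚ] bettiCohomology A.X 1, z = 0 := fun z => by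
          induction z using TensorProduct.induction_on with
          | zero => rfl
          | tmul c' v' => rw [Subsingleton.elim v' 0, TensorProduct.tmul_zero]
          | add a' b' ha hb => rw [ha, hb, add_zero]
        rw [h x, h y]
      intro x y
      rw [Subsingleton.elim (φ.baseChange ℂ x) 0, Subsingleton.elim (φ.baseChange ℂ y) 0, map_zero,
        LinearMap.zero_apply, map_zero, zero_add]
    · exact ThetaSubalgebra.formBaseChange_add_eq_zero_of_skew ψ
        (UnitaryTheta.form_apply_add_form_apply_eq_zero _ ψ hφE hd hφ2 hE)
  have hiso0 : ∀ i j, ψC (cb (0, i)) (cb (0, j)) = 0 := fun i j =>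
    UnitaryTheta.form_eq_zero_of_mem_eigenspace hφskewC hμ0 (hcbW i) (hcbW j)
  have hiso1 : ∀ i j, ψC (cb (1, i)) (cb (1, j)) = 0 := fun i j =>
    UnitaryTheta.form_eq_zero_of_mem_eigenspace hφskewC (neg_ne_zero.2 hμ0) (hcbW' i) (hcbW' j)
  have hswap10 : ∀ i j, ψC (cb (1, i)) (cb (0, j)) = -(if j = i then 1 else 0) := fun i j => by
    rw [hψC, ψ.form_baseChange_swap, show (((1 : ℕ) : ℤ)).negOnePow = -1 from Int.negOnePow_one, ← hψC, hdual]
    split_ifs <;> simp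
  have hφcb : ∀ t ℓ, φ.baseChange ℂ (cb (t, ℓ)) = (if t = 0 then μ else -μ) • cb (t, ℓ) := by
    intro t ℓ
    rcases fin2_cases' t with rfl | rfl
    · rw [if_pos rfl]; exact Module.End.mem_eigenspace_iff.1 (hcbW ℓ)
    · rw [if_neg one_ne_zero]; exact Module.End.mem_eigenspace_iff.1 (hcbW' ℓ)
  -- the invariance of every slice under the typed differentials, via §1
  have key : ∀ (X : Matrix (Fin n₀) (Fin n₀) ℂ) (u : Fin (2 * p) → Fin n),
      wordDerAt ℂ (fun _ : Fin (2 * p) => blockLiftGen φι (fun t : Fin 2 => if t = 0 then X else -Xᵀ))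
        (wordSlice ax u) = 0 := by
    intro X u
    set Nf : Fin 2 → Matrix (Fin n₀) (Fin n₀) ℂ := fun t => if t = 0 then X else -Xᵀ with hNf
    have hNf0 : Nf 0 = X := if_pos rfl
    have hNf1 : Nf 1 = -Xᵀ := if_neg one_ne_zero
    set Y := Matrix.toLin cbσ cbσ (blockLiftGen φι Nf) with hYdef
    have hYcb : ∀ t ℓ, Y (cb (t, ℓ)) = ∑ r, Nf t r ℓ • cb (t, r) :=
      fun t ℓ => toLin_blockLiftGen_apply φι cbσ (⇑cb) hcbσ Nf t ℓ
    have hYφ : Y * φ.baseChange ℂ = φ.baseChange ℂ * Y := by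
      refine cb.ext fun tl => ?_
      obtain ⟨t, ℓ⟩ := tl
      rw [Module.End.mul_apply, Module.End.mul_apply, hφcb, map_smul, hYcb, map_sum, Finset.smul_sum]
      exact Finset.sum_congr rfl fun r _ => by rw [map_smul, hφcb, smul_comm]
    have hYskew : ∀ x y, ψC (Y x) y + ψC x (Y y) = 0 := by
      have hB : ψC ∘ₗ Y + ψC.compl₂ Y = 0 := by
        refine LinearMap.BilinForm.ext_basis cb fun tk tl => ?_
        obtain ⟨t, k⟩ := tk
        obtain ⟨t', ℓ⟩ := tl
        rw [LinearMap.add_apply, LinearMap.add_apply, LinearMap.comp_apply, LinearMap.compl₂_apply,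
          LinearMap.zero_apply, LinearMap.zero_apply, hYcb, hYcb, map_sum, LinearMap.sum_apply, map_sum]
        simp only [map_smul, LinearMap.smul_apply, smul_eq_mul]
        rcases fin2_cases' t with rfl | rfl <;> rcases fin2_cases' t' with rfl | rfl
        · simp [hiso0]
        · simp [hNf0, hNf1, hdual, Matrix.neg_apply, Matrix.transpose_apply, mul_ite, Finset.sum_ite_eq,
            Finset.sum_ite_eq']
        · simp [hNf0, hNf1, hswap10, Matrix.neg_apply, Matrix.transpose_apply, mul_ite, Finset.sum_ite_eq,
            Finset.sum_ite_eq']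
        · simp [hiso1]
      intro x y
      have h := LinearMap.congr_fun (LinearMap.congr_fun hB x) y
      simpa only [LinearMap.add_apply, LinearMap.comp_apply, LinearMap.compl₂_apply, LinearMap.zero_apply]
        using h
    have hL := UnitaryTheta.wordDerAt_eq_zero_of_commute_of_skew_of_hodgeLieC
      (BettiUniverse.hodge hHD (AbelianVariety.isSmoothProjective_holds (A := A)) 1) ψ hU eQ q' hΘ hΘq hYφ
      hYskew u
    rw [← haEq, hslice_e] at hL
    have hYG : ∀ _t : Fin (2 * p), LinearMap.toMatrix eC eC Y * G = G * LinearMap.toMatrix cbσ cbσ Y :=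
      fun _ => by rw [hG, linearMap_toMatrix_mul_basis_toMatrix, basis_toMatrix_mul_linearMap_toMatrix]
    have hblk : LinearMap.toMatrix cbσ cbσ Y = blockLiftGen φι Nf := by
      rw [hYdef, LinearMap.toMatrix_toLin]
    have h3 : wordRepAt ℂ (fun _ : Fin (2 * p) => G)
        (wordDerAt ℂ (fun _ : Fin (2 * p) => blockLiftGen φι Nf) (wordSlice ax u)) = 0 := by
      rw [← hblk, wordRepAt_wordDerAt_of_mul_eq ℂ (fun _ : Fin (2 * p) => G) hYG, hL]
    exact wordRepAt_injective ℂ (g := fun _ : Fin (2 * p) => G) (g' := fun _ : Fin (2 * p) => G')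
      (funext fun _ => hG'G) (by rw [h3, map_zero])
  -- the coefficient function, refined to slot-and-type colours
  refine ⟨placeRefineGen φι ax, ?_, fun U X => ?_⟩
  · rw [← hcax]
    have hx : (fun x : (Fin n × Fin 2) × Fin n₀ => avLetters g v (x.1.1, φι.symm (x.1.2, x.2))) =
        fun x => avLetters g (fun tl : Fin 2 × Fin n₀ =>
          ofRatClassBaseChange (Motives.ComplexPoints A.X) 1 (cb tl)) (x.1.1, (x.1.2, x.2)) := by
      funext x
      rw [avLetters_apply, avLetters_apply, hv_apply, Equiv.apply_symm_apply]
    rw [← hx]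
    exact wordEval_placeRefineGen F φι (avLetters g v) ax
  · exact wordDerAt_placeRefineGen_eq_zero φι (fun t : Fin 2 => if t = 0 then X else -Xᵀ) (key X) U

end Invariance

end Literature.AlgebraicGeometry.HodgeTheory

end
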